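import Literature.NumberTheory.QuadraticFields.ThreeTorsion
import Literature.NumberTheory.QuadraticFields.ReducedForms
import Mathlib.NumberTheory.Zsqrtd.Basic
import HarnessLib

/-!
# The Scholz–Hecke unit criterion for the mirror pair `(ℚ(√3d), ℚ(√−d))` — named fact, with its elementary vocabulary

Cite item `wi-30020` (crux line `mirror-unit-signature` of `stmt-QuantumAdvantage-2427`, stub
`stub_unitCubeCriterion`; companion of `ScholzReflection.lean`). Sources: A. Scholz, J. reine angew. Math.
166 (1932) 201–203 (`s = r` or `r + 1` according to the unit / `3`-primarity defect); L. C. Washington,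
*Introduction to Cyclotomic Fields* (GTM 83), Thm 10.10 AND ITS PROOF (Kummer theory over `K = ℚ(√d, ζ₃)`:
the unramified `C₃`-extensions of `ℚ(√−3d)` come from `K(∛β)`, `β ∈ V = {β : (β) = 𝔟³}/K^{×3}`, and the
unit `ε` of the real field accounts for the defect `s − r ∈ {0, 1}`); E. Hecke, *Vorlesungen über die
Theorie der algebraischen Zahlen* (1923) §39, Satz 118–119 (= *Lectures*, GTM 77, Thms 118–119: a Kummer
extension `K(∛β)/K`, `β` prime to `3`, is unramified at `𝔓 ∣ 3` iff `β` is a cube modulo `𝔓^{3e(𝔓|3)/2}`);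
M. J. Jacobson, H. C. Williams, *Solving the Pell Equation* (2008), Ch. 12 (fundamental unit `(a + b√d₀)/2`,
`a² − d₀b² = ±4`).

THE FACT (`ScholzHecke_unitCubeCriterion`), for `−d` a negative fundamental discriminant, `d ≠ 3`,
`k = ℚ(√3d)` (fundamental discriminant `D⁺ = d/3` or `3d`), `d₀ =` square-free kernel of `3d`,
`ε = (a + b√d₀)/2 > 1` the fundamental unit, `K = k(ζ₃) ∋ √−d`:
(i) if `ε` is a cube modulo `𝔓³` for every prime `𝔓 ∣ 3` of `K` (Hecke's condition, `e(𝔓∣3) = 2`), then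
`K(∛ε)/K` descends to an unramified cyclic cubic extension of `ℚ(√−d)` (unramified outside `3` because `ε`
is a unit with `ε · ε^σ = Nε = ±1` a cube; at `3` by Hecke), hence `3 ∣ h(−d)`;
(ii) if moreover `#Cl(k)[3] = 1`, then conversely `3 ∣ h(−d)` forces (i)'s hypothesis (the Kummer generators
of unramified `C₃`-extensions of `ℚ(√−d)` live in `V_k = {β ∈ k^× : (β) = 𝔟³}/k^{×3}`, of `𝔽₃`-dimension
`rank₃ Cl(k) + 1 = 1`, i.e. `V_k = ⟨ε⟩` — the count in Washington's proof of Thm 10.10).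

ELEMENTARY SPELLING of "`ε` is a cube mod `𝔓³` for all `𝔓 ∣ 3`" used here (the consumer's registered
form; derivation: cubing kills the `1`-units modulo `𝔓³` and is bijective on `(𝒪_K/𝔓)^×`, whose order
`3^f − 1` divides `8`, so the condition is `ε⁸ ≡ 1 (mod rad(3𝒪_K)³ ∩ 𝒪_k)`; `rad(3𝒪_K)³ ∩ 𝒪_k = 9𝒪_k`
if `3 ∤ d₀` (`⟺ 3 ∣ d`; `K/k` ramified over `3`) and `= 𝔭³ = 3𝔭` if `3 ∣ d₀` (`⟺ 3 ∤ d`; `𝔭² = 3𝒪_k`);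
multiplying by the unit `2⁸ ≡ 4 (mod 9)` and using `[𝒪_k : ℤ[√d₀]] ≤ 2` prime to `3`): with
`(a + b√d₀)⁸ = X + Y√d₀ ∈ ℤ[√d₀]`, the condition reads `X ≡ 4 (mod 9)` and `9 ∣ Y` (if `3 ∣ d`), resp.
`X ≡ 4 (mod 9)` and `3 ∣ Y` (if `3 ∤ d`). This translation was derived independently by the planners and
triagers of the line and certified numerically (both implications, `0` violations over all `159 375`
fundamental `−d` with `d < 2¹⁹`, kit job `j012491`); worked checks `d = 23, 87` (cube; `h = 3, 6`),
`d = 24, 20` (not; `h = 2, 2`).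

## Contents

* `mirrorRadicand d = d₀`, `IsMirrorFundUnit d a b`, `unitPow8 d a b = (a + b√d₀)⁸ ∈ ℤ[√d₀]` (Mathlib
  `Zsqrtd`), `UnitCubeAtThree d` — Literature copies, SAME BODIES, of the line's elementary definitions;
* `ScholzHecke_unitCubeCriterion : Prop` — the named fact, verbatim the stub `stub_unitCubeCriterion`
  (with `IsNegFund`, `mirrorDisc` unfolded, `h(−d) = BinaryQuadraticForm.classNumber (−d)` of
  `ReducedForms.lean`, `#Cl₃ = quadFieldThreeTorsion` of `ThreeTorsion.lean`), halves `.cube_imp_three_dvd`,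
  `.three_dvd_imp_cube`.
-/

noncomputable section

namespace Literature.NumberTheory.QuadraticFields

/-- **The mirror radicand** `d₀` = square-free kernel of `3d` (so `ℚ(√d₀) = ℚ(√3d)`, of discriminant
`D⁺ ∈ {d₀, 4d₀}`): strip the `4` of an even fundamental discriminant `−d`, then move the `3` across.
[folklore] -/
def mirrorRadicand (d : ℕ) : ℕ :=
  if 3 ∣ d then (if 4 ∣ d then d / 12 else d / 3) else (if 4 ∣ d then 3 * (d / 4) else 3 * d)

/-- `(a, b)` are the half-integral coordinates of THE fundamental unit `ε = (a + b√d₀)/2 > 1` of the ring of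
integers of `ℚ(√d₀)`, `d₀ = mirrorRadicand d`: `b > 0`, `a² − d₀ b² = ±4`, `a` least (for square-free `d₀`
the units `> 1` are the `(a + b√d₀)/2` with `a² − d₀b² = ±4`, `a, b > 0`, and `a = ε ± ε⁻¹` increases along
powers). [cite: JacobsonWilliams2008, Ch. 12] -/
def IsMirrorFundUnit (d a b : ℕ) : Prop :=
  0 < b ∧
    ((a:ℤ) ^ 2 - (mirrorRadicand d : ℤ) * (b:ℤ) ^ 2 = 4 ∨ (a:ℤ) ^ 2 - (mirrorRadicand d : ℤ) * (b:ℤ) ^ 2 = -4) ∧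
    ∀ a' b' : ℕ, 0 < b' →
      ((a':ℤ) ^ 2 - (mirrorRadicand d : ℤ) * (b':ℤ) ^ 2 = 4 ∨ (a':ℤ) ^ 2 - (mirrorRadicand d : ℤ) * (b':ℤ) ^ 2 = -4) →
        a ≤ a'

/-- `(a + b√d₀)⁸ = 2⁸ ε⁸ ∈ ℤ[√d₀]` (Mathlib `Zsqrtd`; `.re`, `.im` its coordinates). [folklore] -/
def unitPow8 (d a b : ℕ) : Zsqrtd (mirrorRadicand d : ℤ) :=
  (⟨(a:ℤ), (b:ℤ)⟩ : Zsqrtd (mirrorRadicand d : ℤ)) ^ 8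

/-- **The unit signature "`ε_{ℚ(√3d)}` is a cube modulo `𝔓³` for every `𝔓 ∣ 3` of `ℚ(√3d, ζ₃)`", arithmetic
spelling** (see the module docstring for the derivation from Hecke, Satz 119): with
`(a + b√d₀)⁸ = X + Y√d₀` for the fundamental unit `(a + b√d₀)/2`: `X ≡ 4 (mod 9)`, and `9 ∣ Y` if `3 ∣ d`,
`3 ∣ Y` if `3 ∤ d`. The witness `(a, b)` is unique, so the `∃` is a definite description.
[cite: Scholz1932, pp. 201–203] [cite: JacobsonWilliams2008, Ch. 12] -/
def UnitCubeAtThree (d : ℕ) : Prop :=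
  ∃ a b : ℕ, IsMirrorFundUnit d a b ∧ (unitPow8 d a b).re % 9 = 4 ∧
    (3 ∣ d → (9:ℤ) ∣ (unitPow8 d a b).im) ∧ (¬ 3 ∣ d → (3:ℤ) ∣ (unitPow8 d a b).im)

/-- **The Scholz–Hecke unit criterion** (the unit defect in Scholz's reflection theorem made explicit;
Scholz 1932; Washington, *Introduction to Cyclotomic Fields*, proof of Thm 10.10; Hecke, *Vorlesungen*,
Satz 118–119 for the ramification at `3`): for `−d` a negative fundamental discriminant and `d ≠ 3`,
(i) `UnitCubeAtThree d → 3 ∣ h(−d)`, and (ii) if `#Cl(ℚ(√3d))[3] = 1` (`quadFieldThreeTorsion D⁺ = 1`,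
`D⁺ = if 3 ∣ d then d/3 else 3d`) then `3 ∣ h(−d) → UnitCubeAtThree d`; `h(−d)` is the form class number
`BinaryQuadraticForm.classNumber (−d)` (`= h(ℚ(√−d))` for fundamental `−d`, Cox Thm 7.7). Verbatim the stub
`stub_unitCubeCriterion` of `Cruxes/AvgFaceBeyondPrior/Lines/mirror-unit-signature.lean`, over the Literature
copies of its vocabulary. [cite: Scholz1932, pp. 201–203] [cite: Washington1997, Thm 10.10 (proof)] -/
def ScholzHecke_unitCubeCriterion : Prop :=
  ∀ d : ℕ, (((-(d:ℤ)) % 4 = 1 ∧ Squarefree (-(d:ℤ)) ∧ (-(d:ℤ)) ≠ 1) ∨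
      (4 ∣ (-(d:ℤ)) ∧ ((-(d:ℤ)) / 4 % 4 = 2 ∨ (-(d:ℤ)) / 4 % 4 = 3) ∧ Squarefree ((-(d:ℤ)) / 4))) →
    d ≠ 3 →
    (UnitCubeAtThree d → 3 ∣ BinaryQuadraticForm.classNumber (-(d:ℤ))) ∧
      (quadFieldThreeTorsion (if 3 ∣ d then ((d / 3 : ℕ) : ℤ) else 3 * (d : ℤ)) = 1 →
        3 ∣ BinaryQuadraticForm.classNumber (-(d:ℤ)) → UnitCubeAtThree d)

/-- Direction (i) of the criterion: the unit is a cube at `3` ⇒ `3 ∣ h(−d)`.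
[cite: Washington1997, Thm 10.10 (proof)] -/
theorem ScholzHecke_unitCubeCriterion.cube_imp_three_dvd (h : ScholzHecke_unitCubeCriterion) {d : ℕ}
    (hd : ((-(d:ℤ)) % 4 = 1 ∧ Squarefree (-(d:ℤ)) ∧ (-(d:ℤ)) ≠ 1) ∨
      (4 ∣ (-(d:ℤ)) ∧ ((-(d:ℤ)) / 4 % 4 = 2 ∨ (-(d:ℤ)) / 4 % 4 = 3) ∧ Squarefree ((-(d:ℤ)) / 4)))
    (h3 : d ≠ 3) (hu : UnitCubeAtThree d) : 3 ∣ BinaryQuadraticForm.classNumber (-(d:ℤ)) :=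
  (h d hd h3).1 hu

/-- Direction (ii) of the criterion: if `ℚ(√3d)` has no `3`-torsion class, `3 ∣ h(−d)` ⇒ the unit is a cube
at `3`. [cite: Washington1997, Thm 10.10 (proof)] -/
theorem ScholzHecke_unitCubeCriterion.three_dvd_imp_cube (h : ScholzHecke_unitCubeCriterion) {d : ℕ}
    (hd : ((-(d:ℤ)) % 4 = 1 ∧ Squarefree (-(d:ℤ)) ∧ (-(d:ℤ)) ≠ 1) ∨
      (4 ∣ (-(d:ℤ)) ∧ ((-(d:ℤ)) / 4 % 4 = 2 ∨ (-(d:ℤ)) / 4 % 4 = 3) ∧ Squarefree ((-(d:ℤ)) / 4)))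
    (h3 : d ≠ 3) (ht : quadFieldThreeTorsion (if 3 ∣ d then ((d / 3 : ℕ) : ℤ) else 3 * (d : ℤ)) = 1)
    (hh : 3 ∣ BinaryQuadraticForm.classNumber (-(d:ℤ))) : UnitCubeAtThree d :=
  (h d hd h3).2 ht hh

/-- Worked check `d = 23` (`d₀ = 69`, `ε = (25 + 3√69)/2`): `(25 + 3√69)⁸ ≡ 4 + 6√69 (mod 9)`, so the unit
IS a cube at `3` in the arithmetic spelling (and indeed `h(−23) = 3`). [folklore] -/
example : (unitPow8 23 25 3).re % 9 = 4 ∧ (3:ℤ) ∣ (unitPow8 23 25 3).im := by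
  unfold unitPow8 mirrorRadicand
  norm_num
  decide

end Literature.NumberTheory.QuadraticFields

end
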